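import Summits.KontsevichZagierPeriods.Zeta5Search.TwoTaleRungACells

/-!
# Rung A: the inclusion input `InclusionA` is a theorem

HONEST FRAMING: systematic search; no irrationality claim unless certified.

Cell pub-zeta5, T3 service (P1 g9) [Zudilin2014ZetaTwo, Lemma 7, Remark 3].  fam-denom's rung-A input node
`Denom.TwoTaleR3Forms.InclusionA` — `Φₙ ∣ D₇ₙ² qₙ` and `Φₙ⁻¹ D₇ₙ² pₙ ∈ ℤ` for all `n ≥ 1`, with
`Φₙ = Denom.TwoTaleR3Saving.savingProductA n = ∏_{i<7} ∏{p ≤ 7n prime : 8n < p², {n/p} ∈ ivlA i}` — is PROVED here,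
unconditionally (`inclusionA_holds`), from the 7 first-tale interval theorems `ivlA_0 … ivlA_6` (`TwoTaleRungACells`).
The prime-by-prime glue (`ivlMultA`, `factorization_savingProductA`, disjointness of the intervals of one level,
`prime_pow_ivlMultA_dvd_of_levels`) is a clone, for the 7-interval table `ivlA` (`C = 8`, cut `7n`), of fam-denom g6's
`Denom/TwoTaleP15SavingAPI` + `Denom/TwoTaleP15Levels` (20-interval table of P15) — credit to fam-denom.
With fam-measure's `TwoTaleR3Growth*` this leaves `DecayA` and the printed Whipple identity `WhippleA` as the only inputs
of `zetaTwo_exponent_le_of_whippleA` (exponent 5.2054 for ζ(2), Zudilin's Remark 3; NOT a record, not claimed).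
-/

noncomputable section

namespace Summit.KontsevichZagierPeriods.Zeta5Search.TwoTaleRungA

open Finset
open Literature.NumberTheory.DiophantineApproximation.RhinViola
open Denom.TwoTaleR3Saving (ivlA primeCutA ivlProductA savingProductA ivlProductA_pos savingProductA_pos)
open Denom.TwoTaleR3Forms (formQA formPA lcmNormaliserA InclusionA)

/-! ### Counted primes (clone of `TwoTaleP15SavingAPI` for `ivlA`) -/

/-- A prime `p` is counted in `ivlA i = [uᵢ, vᵢ)` at `n` iff `p ≤ 7n`, `8n < p²` and `uᵢ ≤ {n/p} < vᵢ`. -/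
theorem mem_classPrimes_ivlA_iff {i n p : ℕ} :
    p ∈ classPrimes 8 primeCutA (ivlA i) n ↔
      p.Prime ∧ p ≤ 7 * n ∧ (8 : ℝ) * n < (p : ℝ) ^ 2 ∧
        (ivlA i).1 ≤ Int.fract ((n : ℝ) / p) ∧ Int.fract ((n : ℝ) / p) < (ivlA i).2 := by
  simp only [classPrimes, primeCutA, mem_filter, mem_range]
  constructor
  · rintro ⟨h1, h2, h3, h4, h5⟩
    exact ⟨h2, by omega, h3, h4, h5⟩
  · rintro ⟨h2, h1, h3, h4, h5⟩
    exact ⟨by omega, h2, h3, h4, h5⟩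

/-- A counted prime satisfies the hypotheses of the interval theorems `ivlA_i`. -/
theorem hyps_of_mem_classPrimes_ivlA {i n p : ℕ} (h : p ∈ classPrimes 8 primeCutA (ivlA i) n) :
    p.Prime ∧ 8 * n < p ^ 2 ∧ (ivlA i).1 ≤ Int.fract ((n : ℝ) / p) ∧ Int.fract ((n : ℝ) / p) < (ivlA i).2 := by
  obtain ⟨hp, -, h2, h3, h4⟩ := mem_classPrimes_ivlA_iff.1 h
  exact ⟨hp, by exact_mod_cast h2, h3, h4⟩

/-- `ivlProductA i n` is the plain product of the primes of class `i`. -/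
theorem ivlProductA_eq (i n : ℕ) : ivlProductA i n = ∏ p ∈ classPrimes 8 primeCutA (ivlA i) n, p := by
  simp [ivlProductA, classPrimeProduct, Finset.singleton_biUnion]

/-- **Multiplicity of `p` in `Φₙ`**: the number of the seven intervals whose class contains `p`. -/
def ivlMultA (n p : ℕ) : ℕ := ((range 7).filter fun i => p ∈ classPrimes 8 primeCutA (ivlA i) n).card

/-- `v_p` of one class product: `1` if `p` is in the class, else `0`. -/
theorem factorization_ivlProductA (i n p : ℕ) :
    (ivlProductA i n).factorization p = if p ∈ classPrimes 8 primeCutA (ivlA i) n then 1 else 0 := by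
  rw [ivlProductA_eq, Nat.factorization_prod fun q hq => (prime_of_mem_classPrimes hq).ne_zero,
    Finsupp.finsetSum_apply]
  have h : ∀ q ∈ classPrimes 8 primeCutA (ivlA i) n, q.factorization p = if q = p then 1 else 0 :=
    fun q hq => by rw [(prime_of_mem_classPrimes hq).factorization, Finsupp.single_apply]
  rw [sum_congr rfl h, sum_ite_eq']

/-- **`(Φₙ).factorization p = ivlMultA n p`.** -/
theorem factorization_savingProductA (n p : ℕ) : (savingProductA n).factorization p = ivlMultA n p := by
  rw [savingProductA, Nat.factorization_prod fun i _ => (ivlProductA_pos i n).ne', Finsupp.finsetSum_apply]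
  simp_rw [factorization_ivlProductA]
  rw [ivlMultA, card_filter]

/-- **`Φₙ ∣ M ↔ ∀ p prime, ivlMultA n p ≤ v_p(M)`** (`M ≠ 0`). -/
theorem savingProductA_dvd_iff {n M : ℕ} (hM : M ≠ 0) :
    savingProductA n ∣ M ↔ ∀ p : ℕ, p.Prime → ivlMultA n p ≤ padicValNat p M := by
  rw [← Nat.factorization_le_iff_dvd (savingProductA_pos n).ne' hM, Finsupp.le_def]
  constructor
  · intro h p hp
    have h' := h p
    rwa [factorization_savingProductA, Nat.factorization_def _ hp] at h'
  · intro h p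
    by_cases hp : p.Prime
    · rw [factorization_savingProductA, Nat.factorization_def _ hp]; exact h p hp
    · rw [Nat.factorization_eq_zero_of_not_prime _ hp]; exact Nat.zero_le _

/-- **Prime powers suffice:** if `p ^ ivlMultA n p ∣ z` for every prime `p`, then `Φₙ ∣ z`. -/
theorem savingProductA_dvd_int_of_prime_pow_dvd {n : ℕ} {z : ℤ}
    (h : ∀ p : ℕ, p.Prime → (p : ℤ) ^ ivlMultA n p ∣ z) : (savingProductA n : ℤ) ∣ z := by
  rcases eq_or_ne z 0 with rfl | hz
  · exact dvd_zero _
  have h' : savingProductA n ∣ z.natAbs := by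
    rw [savingProductA_dvd_iff (Int.natAbs_ne_zero.2 hz)]
    intro p hp
    haveI := Fact.mk hp
    have := ((padicValInt_dvd_iff _ _).1 (h p hp)).resolve_left hz
    simpa [padicValInt] using this
  exact Int.natCast_dvd.2 h'

/-! ### The intervals of one level are pairwise disjoint (clone of `TwoTaleP15Levels`) -/

/-- `vᵢ ≤ uⱼ` for `i < j < 3` (level 1). -/
theorem lvl1A_sep {i j : ℕ} (hij : i < j) (hj : j < 3) : (ivlA i).2 ≤ (ivlA j).1 := by
  interval_cases j <;> interval_cases i <;> norm_num [ivlA]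

/-- `vᵢ ≤ uⱼ` for `3 ≤ i < j < 7` (level 2). -/
theorem lvl2A_sep {i j : ℕ} (hi : 3 ≤ i) (hij : i < j) (hj : j < 7) : (ivlA i).2 ≤ (ivlA j).1 := by
  interval_cases j <;> interval_cases i <;> norm_num [ivlA]

/-- The three level-1 intervals are pairwise disjoint. -/
theorem lvl1A_unique {x : ℝ} {i j : ℕ} (hi : i < 3) (hj : j < 3)
    (h1 : (ivlA i).1 ≤ x) (h2 : x < (ivlA i).2) (h3 : (ivlA j).1 ≤ x) (h4 : x < (ivlA j).2) : i = j := by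
  by_contra hne
  rcases Nat.lt_or_gt_of_ne hne with h | h
  · have := lvl1A_sep h hj; linarith
  · have := lvl1A_sep h hi; linarith

/-- The four level-2 intervals are pairwise disjoint. -/
theorem lvl2A_unique {x : ℝ} {i j : ℕ} (hi : 3 ≤ i) (hi' : i < 7) (hj : 3 ≤ j) (hj' : j < 7)
    (h1 : (ivlA i).1 ≤ x) (h2 : x < (ivlA i).2) (h3 : (ivlA j).1 ≤ x) (h4 : x < (ivlA j).2) : i = j := by
  by_contra hne
  rcases Nat.lt_or_gt_of_ne hne with h | h
  · have := lvl2A_sep hi h hj'; linarith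
  · have := lvl2A_sep hj h hi'; linarith

/-- At most one level-1 interval counts a given `p`. -/
theorem card_filter_lvl1A_le_one (n p : ℕ) :
    ((Ico 0 3).filter fun i => p ∈ classPrimes 8 primeCutA (ivlA i) n).card ≤ 1 := by
  refine card_le_one.2 fun i hi j hj => ?_
  simp only [mem_filter, mem_Ico] at hi hj
  obtain ⟨-, -, a1, a2⟩ := hyps_of_mem_classPrimes_ivlA hi.2
  obtain ⟨-, -, b1, b2⟩ := hyps_of_mem_classPrimes_ivlA hj.2
  exact lvl1A_unique hi.1.2 hj.1.2 a1 a2 b1 b2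

/-- At most one level-2 interval counts a given `p`. -/
theorem card_filter_lvl2A_le_one (n p : ℕ) :
    ((Ico 3 7).filter fun i => p ∈ classPrimes 8 primeCutA (ivlA i) n).card ≤ 1 := by
  refine card_le_one.2 fun i hi j hj => ?_
  simp only [mem_filter, mem_Ico] at hi hj
  obtain ⟨-, -, a1, a2⟩ := hyps_of_mem_classPrimes_ivlA hi.2
  obtain ⟨-, -, b1, b2⟩ := hyps_of_mem_classPrimes_ivlA hj.2
  exact lvl2A_unique hi.1.1 hi.1.2 hj.1.1 hj.1.2 a1 a2 b1 b2

/-- `ivlMultA` splits into its level-1 and level-2 counts. -/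
theorem ivlMultA_eq_add (n p : ℕ) :
    ivlMultA n p = ((Ico 0 3).filter fun i => p ∈ classPrimes 8 primeCutA (ivlA i) n).card +
      ((Ico 3 7).filter fun i => p ∈ classPrimes 8 primeCutA (ivlA i) n).card := by
  have h : range 7 = Ico 0 3 ∪ Ico 3 7 := by
    rw [range_eq_Ico, Ico_union_Ico_eq_Ico (by norm_num) (by norm_num)]
  unfold ivlMultA
  rw [h, filter_union, card_union_of_disjoint]
  exact disjoint_filter_filter (Ico_disjoint_Ico_consecutive 0 3 7)

/-- `φ ≤ 2`: every prime is counted at most twice. -/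
theorem ivlMultA_le_two (n p : ℕ) : ivlMultA n p ≤ 2 := by
  rw [ivlMultA_eq_add]
  have := card_filter_lvl1A_le_one n p
  have := card_filter_lvl2A_le_one n p
  omega

/-- **Level divisibilities give `p ^ ivlMultA n p ∣ M`.** -/
theorem prime_pow_ivlMultA_dvd_of_levels {n : ℕ} {M : ℤ}
    (h1 : ∀ i < 3, ∀ p ∈ classPrimes 8 primeCutA (ivlA i) n, (p : ℤ) ∣ M)
    (h2 : ∀ i, 3 ≤ i → i < 7 → ∀ p ∈ classPrimes 8 primeCutA (ivlA i) n, (p : ℤ) ^ 2 ∣ M)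
    (p : ℕ) : (p : ℤ) ^ ivlMultA n p ∣ M := by
  have c1 := card_filter_lvl1A_le_one n p
  rw [ivlMultA_eq_add]
  rcases ((Ico 3 7).filter fun i => p ∈ classPrimes 8 primeCutA (ivlA i) n).eq_empty_or_nonempty with hS | ⟨i, hi⟩
  · rw [hS, card_empty, add_zero]
    rcases ((Ico 0 3).filter fun i => p ∈ classPrimes 8 primeCutA (ivlA i) n).eq_empty_or_nonempty
      with hT | ⟨j, hj⟩
    · rw [hT, card_empty, pow_zero]; exact one_dvd _
    · rw [le_antisymm c1 (card_pos.2 ⟨j, hj⟩), pow_one]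
      simp only [mem_filter, mem_Ico] at hj
      exact h1 j hj.1.2 p hj.2
  · have hp2 : (p : ℤ) ^ 2 ∣ M := by
      simp only [mem_filter, mem_Ico] at hi
      exact h2 i hi.1.1 hi.1.2 p hi.2
    refine (pow_dvd_pow _ ?_).trans hp2
    have := ivlMultA_le_two n p
    rw [ivlMultA_eq_add] at this
    exact this

/-- **`Φₙ ∣ M` from level divisibilities in the unpacked shape** of the interval theorems. -/
theorem savingProductA_dvd_of_unpacked {n : ℕ} {M : ℤ}
    (h1 : ∀ i < 3, ∀ p : ℕ, p.Prime → 8 * n < p ^ 2 →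
      (ivlA i).1 ≤ Int.fract ((n : ℝ) / p) → Int.fract ((n : ℝ) / p) < (ivlA i).2 → (p : ℤ) ∣ M)
    (h2 : ∀ i, 3 ≤ i → i < 7 → ∀ p : ℕ, p.Prime → 8 * n < p ^ 2 →
      (ivlA i).1 ≤ Int.fract ((n : ℝ) / p) → Int.fract ((n : ℝ) / p) < (ivlA i).2 → (p : ℤ) ^ 2 ∣ M) :
    (savingProductA n : ℤ) ∣ M := by
  refine savingProductA_dvd_int_of_prime_pow_dvd fun p _ => prime_pow_ivlMultA_dvd_of_levels
    (fun i hi q hq => ?_) (fun i hi hi' q hq => ?_) p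
  · obtain ⟨a, b, c, d⟩ := hyps_of_mem_classPrimes_ivlA hq
    exact h1 i hi q a b c d
  · obtain ⟨a, b, c, d⟩ := hyps_of_mem_classPrimes_ivlA hq
    exact h2 i hi hi' q a b c d

/-! ### The seven intervals, level by level, and `InclusionA` -/

/-- **Level 1** (`ivlA 0, 1, 2`): `p ∣ q_n` and `p ∣ D₇ₙ² p_n`. -/
theorem level1A_dvd {n : ℕ} (hn : 1 ≤ n) {i : ℕ} (hi : i < 3) {p : ℕ} (hp : p.Prime) (hp2 : 8 * n < p ^ 2)
    (hu : (ivlA i).1 ≤ Int.fract ((n : ℝ) / p)) (hv : Int.fract ((n : ℝ) / p) < (ivlA i).2) :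
    (p : ℤ) ∣ formQA n ∧ (p : ℤ) ∣ pAnum n := by
  interval_cases i
  · simpa using ivlA_0 hn hp hp2 (by simpa [ivlA] using hu) (by simpa [ivlA] using hv)
  · simpa using ivlA_1 hn hp hp2 (by simpa [ivlA] using hu) (by simpa [ivlA] using hv)
  · simpa using ivlA_2 hn hp hp2 (by simpa [ivlA] using hu) (by simpa [ivlA] using hv)

/-- **Level 2** (`ivlA 3, 4, 5, 6`): `p² ∣ q_n` and `p² ∣ D₇ₙ² p_n`. -/
theorem level2A_dvd {n : ℕ} (hn : 1 ≤ n) {i : ℕ} (hi : 3 ≤ i) (hi' : i < 7) {p : ℕ} (hp : p.Prime)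
    (hp2 : 8 * n < p ^ 2)
    (hu : (ivlA i).1 ≤ Int.fract ((n : ℝ) / p)) (hv : Int.fract ((n : ℝ) / p) < (ivlA i).2) :
    (p : ℤ) ^ 2 ∣ formQA n ∧ (p : ℤ) ^ 2 ∣ pAnum n := by
  interval_cases i
  · exact ivlA_3 hn hp hp2 (by simpa [ivlA] using hu) (by simpa [ivlA] using hv)
  · exact ivlA_4 hn hp hp2 (by simpa [ivlA] using hu) (by simpa [ivlA] using hv)
  · exact ivlA_5 hn hp hp2 (by simpa [ivlA] using hu) (by simpa [ivlA] using hv)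
  · exact ivlA_6 hn hp hp2 (by simpa [ivlA] using hu) (by simpa [ivlA] using hv)

/-- **`Φₙ ∣ q_n`** at rung A (`n ≥ 1`), unconditionally. -/
theorem savingProductA_dvd_formQA {n : ℕ} (hn : 1 ≤ n) : (savingProductA n : ℤ) ∣ formQA n :=
  savingProductA_dvd_of_unpacked
    (fun _ hi _ hp hp2 hu hv => (level1A_dvd hn hi hp hp2 hu hv).1)
    (fun _ hi hi' _ hp hp2 hu hv => (level2A_dvd hn hi hi' hp hp2 hu hv).1)

/-- **`Φₙ ∣ D₇ₙ² p_n`** at rung A (`n ≥ 1`), unconditionally. -/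
theorem savingProductA_dvd_pAnum {n : ℕ} (hn : 1 ≤ n) : (savingProductA n : ℤ) ∣ pAnum n :=
  savingProductA_dvd_of_unpacked
    (fun _ hi _ hp hp2 hu hv => (level1A_dvd hn hi hp hp2 hu hv).2)
    (fun _ hi hi' _ hp hp2 hu hv => (level2A_dvd hn hi hi' hp hp2 hu hv).2)

/-- `D₇ₙ² · formPA n = pAnum n`. -/
theorem pAnum_eq {n : ℕ} (hn : 1 ≤ n) : ((lcmNormaliserA n : ℕ) : ℚ) * formPA n = (pAnum n : ℚ) := by
  rw [pAnum_cast hn, Denom.TwoTaleR3Forms.lcmNormaliserA]; push_cast; ring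

/-- **`InclusionA` holds** [Zudilin2014ZetaTwo, Lemma 7 at the point of Remark 3]: for every `n ≥ 1`,
`Φₙ ∣ D₇ₙ² q_n` and `Φₙ⁻¹ D₇ₙ² p_n ∈ ℤ` — fam-denom's rung-A inclusion input, now a kernel theorem (first tale only:
no second tale, no two-tale coincidence, no Whipple identity). -/
theorem inclusionA_holds : InclusionA := by
  intro n hn
  have hΦ : (savingProductA n : ℚ) ≠ 0 := by exact_mod_cast (savingProductA_pos n).ne'
  refine ⟨?_, ⟨pAnum n / (savingProductA n : ℤ), ?_⟩⟩
  · obtain ⟨B, hB⟩ := savingProductA_dvd_formQA hn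
    exact ⟨((lcmNormaliserA n : ℕ) : ℤ) * B, by rw [hB]; ring⟩
  · rw [pAnum_eq hn, Int.cast_div (savingProductA_dvd_pAnum hn) (by exact_mod_cast (savingProductA_pos n).ne'),
      Int.cast_natCast, mul_div_cancel₀ _ hΦ]

end Summit.KontsevichZagierPeriods.Zeta5Search.TwoTaleRungA

end
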